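import Summits.AtomisticToContinuum.Crystallization.Theses.PerronTransitivity
import Summits.AtomisticToContinuum.Crystallization.Theses.HullMinimality
import Summits.AtomisticToContinuum.Crystallization.Theorems.PerronTransitivityTransitiveLocalLimitStubExtract
import Summits.AtomisticToContinuum.Crystallization.Theorems.PerronTransitivityTransitiveLocalLimitStubPeriodTwoHullPoint
import Summits.AtomisticToContinuum.Crystallization.Theorems.PerronTransitivityTransitiveLocalLimitStubSiteSumConst
import Summits.AtomisticToContinuum.Crystallization.Theorems.PerronTransitivityTransitiveLocalLimitStubLevel
import Summits.AtomisticToContinuum.Crystallization.Theorems.ChessboardParticlePlanesPeriodicWindowsOfBarlowWindows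
import Summits.AtomisticToContinuum.Crystallization.Theorems.HullMinimalityAssembly
import Summits.AtomisticToContinuum.Crystallization.Theorems.HullMinimalityHullCriterionConverse
import Summits.AtomisticToContinuum.Crystallization.Theorems.ReggeStarCoercivityDefectFreeCrystallizesHullCriterion

/-!
# `TransitiveLocalLimit` from `LayeredWindows` (crux stmt-AtomisticToContinuum-15100, line `MotifTwo`)

Route `PerronTransitivity`, crux rank 4 `TransitiveLocalLimit`: every sequence of Lennard-Jones ground states has,
along a subsequence and after translations, a non-empty uniformly discrete local limit EVERY site of which has site
energy exactly `2E*` (`E* = ⨅_Q e_LJ(Q)`).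

THE DOOR (line `MotifTwo`, card `Cruxes/TransitiveLocalLimit/Ideas/period-two-hull-point.md`): the rank-2 crux
`HullMinimality.LayeredWindows` (stmt-AtomisticToContinuum-11778: ONE layered window per scale, frequently in `N`,
common in-layer spacing `a ∈ [47/50, 1]`, free Hägg word, free gaps) implies `TransitiveLocalLimit`. Composition of
the four landed stubs of the line (namespace `…Theorems.TransitiveLocalLimitMotifTwo`):

1. `stub_periodTwoHullPoint` (p154000) — the landed 11779 chain (`LayeredHull.stub_extraction → stub_recurrence →
   stub_closing`) produces a FAULT-FREE, EQUALLY SPACED layered set `S = A(S(a, s, z))` in the hull of the ground states;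
2. `stub_siteSum_const` (p154003) — motif-two inversion in layer-cake form: all site sums of such a set are equal;
3. `stub_level` (p153999) — window bounds (U)/(L) on prisms + `crysEnergyLimit`: the common value is `2E*`;
4. `stub_extract` (p153518) — "in the hull, frequently in `N`" ⇒ subsequence + translations, eventually matched.

BY-PRODUCT FOR THE BOARD (same four stubs + `LayeredHull.pgl_readoff`): the period-two hull point is the point set of a
periodic configuration `P` whose every site is bound at exactly `2E*`, so `e(P) = E*` is ATTAINED —
`crysPeriodicMinAttained_of_layeredWindows : LayeredWindows → HullMinimality.CrysPeriodicMinAttained` (item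
stmt-AtomisticToContinuum-0627, rank-4 crux of route `HullMinimality`, open). With the proved items of that route
(`PeriodicGivenLayered_proof` 11779, `PrestressSplitKorn.stub_hullCriterion` 3243, `hullCriterionConverse_proof` 11780,
`crysEnergyLimit` 0626, `hullMinimality_assembly_proof` 11781) its deciding theorem `HullMinimality.closes` then needs
`LayeredWindows` ONLY: `crystallization_of_layeredWindows : LayeredWindows → Crystallization`, and through the landed
bridge `PeriodicWindowsSketch.LayeredWindows_of_laminarBarlowWindows` (14292 ⇒ 11778) also
`crystallization_of_laminarBarlowWindows`. No stacking selection beyond 11779's certified registry gap, no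
identification `E* = e_hcp`, no K*, no rooted matching is used anywhere. [folklore]
-/

noncomputable section

namespace Summit.AtomisticToContinuum.Crystallization.Theorems.TransitiveLocalLimitMotifTwo

open Filter
open Literature.MathematicalPhysics.StatisticalMechanics
open Summit.AtomisticToContinuum.Crystallization.Theorems.LayeredHull
open Summit.AtomisticToContinuum.Crystallization.Theses

/-- **The transitive period-two hull point** (per ground-state sequence): layered windows at every scale with common
`a ∈ [47/50, 1]` give a fault-free, equally spaced layered set `S` in the hull of `x`, `1/2`-separated and non-empty,
EVERY site of which has site sum exactly `2E*`. [folklore] -/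
theorem periodTwoHullPoint_transitive (x : (N : ℕ) → (Fin N → EuclideanSpace ℝ (Fin 3)))
    (hx : ∀ N, IsGroundState lennardJones (x N)) (a : ℝ) (ha : 47 / 50 ≤ a) (ha1 : a ≤ 1)
    (hW : ∀ R ε : ℝ, 0 < ε → ∃ᶠ N in atTop, ∃ (A : EuclideanSpace ℝ (Fin 3) →ₗᵢ[ℝ] EuclideanSpace ℝ (Fin 3))
      (t : EuclideanSpace ℝ (Fin 3)) (s : ℤ → ℤ) (z : ℤ → ℝ), IsHaggSeq s ∧
      (∀ m : ℤ, 39 / 50 * a ≤ z (m + 1) - z m ∧ z (m + 1) - z m ≤ 17 / 20 * a) ∧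
      ((∀ p ∈ {p : EuclideanSpace ℝ (Fin 3) | ∃ m i j : ℤ, p = A (((i : ℝ) • triangularVec₁ a) +
          ((j : ℝ) • triangularVec₂ a) + ((haggLabel s m : ℝ) • barlowOffset a) + (z m • layerNormal 1))},
          ‖p‖ ≤ R → ∃ i : Fin N, dist (x N i + t) p ≤ ε) ∧
        (∀ i : Fin N, ‖x N i + t‖ ≤ R → ∃ p ∈ {p : EuclideanSpace ℝ (Fin 3) | ∃ m i j : ℤ,
          p = A (((i : ℝ) • triangularVec₁ a) + ((j : ℝ) • triangularVec₂ a) +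
            ((haggLabel s m : ℝ) • barlowOffset a) + (z m • layerNormal 1))}, dist (x N i + t) p ≤ ε))) :
    ∃ (A : EuclideanSpace ℝ (Fin 3) →ₗᵢ[ℝ] EuclideanSpace ℝ (Fin 3)) (s : ℤ → ℤ) (z : ℤ → ℝ)
      (S : Set (EuclideanSpace ℝ (Fin 3))),
      S = {p : EuclideanSpace ℝ (Fin 3) | ∃ m i j : ℤ, p = A (((i : ℝ) • triangularVec₁ a) +
        ((j : ℝ) • triangularVec₂ a) + ((haggLabel s m : ℝ) • barlowOffset a) + (z m • layerNormal 1))} ∧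
      IsHaggSeq s ∧ (∀ m : ℤ, 39 / 50 * a ≤ z (m + 1) - z m ∧ z (m + 1) - z m ≤ 17 / 20 * a) ∧
      (∀ m : ℤ, s (m + 1) = -s m) ∧ (∀ m : ℤ, z (m + 2) - z (m + 1) = z (m + 1) - z m) ∧
      (∀ R ε : ℝ, 0 < ε → ∃ᶠ N in atTop, ∃ t : EuclideanSpace ℝ (Fin 3),
        (∀ p ∈ S, ‖p‖ ≤ R → ∃ i : Fin N, dist (x N i + t) p ≤ ε) ∧
        (∀ i : Fin N, ‖x N i + t‖ ≤ R → ∃ p ∈ S, dist (x N i + t) p ≤ ε)) ∧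
      S.Nonempty ∧ (∀ p ∈ S, ∀ q ∈ S, p ≠ q → 1 / 2 ≤ dist p q) ∧
      ∀ p ∈ S, (∑' q : {q : EuclideanSpace ℝ (Fin 3) // q ∈ S ∧ q ≠ p},
        lennardJones (dist p (q : EuclideanSpace ℝ (Fin 3)))) =
        2 * ⨅ Q : PeriodicConfiguration 3, Q.energyPerParticle lennardJones := by
  -- (2) a fault-free, equally spaced layered set `S` in the hull (named, with its defining equation)
  obtain ⟨A, s, z, S, hS, hs, hz, hfault, hconst, hH⟩ := stub_periodTwoHullPoint x hx a ha ha1 hW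
  have hz1 : ∀ m : ℤ, 39 / 50 * a ≤ z (m + 1) - z m := fun m => (hz m).1
  -- the set is non-empty and `1/2`-separated
  have hp₀ : A ((((0 : ℤ) : ℝ) • triangularVec₁ a) + (((0 : ℤ) : ℝ) • triangularVec₂ a) +
      ((haggLabel s 0 : ℝ) • barlowOffset a) + (z 0 • layerNormal 1)) ∈ S := by
    rw [hS]; exact ⟨0, 0, 0, rfl⟩
  have hsep : ∀ p ∈ S, ∀ q ∈ S, p ≠ q → 1 / 2 ≤ dist p q := by
    subst hS; exact cake_separated a ha A s z hz1
  -- (3) all site sums equal the site sum `u` at the base point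
  have hu : ∀ p ∈ S, (∑' q : {q : EuclideanSpace ℝ (Fin 3) // q ∈ S ∧ q ≠ p},
      lennardJones (dist p (q : EuclideanSpace ℝ (Fin 3)))) = _ :=
    fun p hp => stub_siteSum_const a ha ha1 A s z hz1 hfault hconst S hS p hp _ hp₀
  -- (4) the level is `2E*`
  have hlevel := stub_level x hx a ha ha1 A s z hs hz S hS hH _ hu
  refine ⟨A, s, z, S, hS, hs, hz, hfault, hconst, hH, ⟨_, hp₀⟩, hsep, fun p hp => ?_⟩
  rw [← hlevel]
  exact hu p hp

/-- **THE DOOR `LayeredWindows → TransitiveLocalLimit`** (crux stmt-AtomisticToContinuum-15100 reduced in-tree to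
the rank-2 crux stmt-AtomisticToContinuum-11778 of route `HullMinimality`): composition of the line's four landed
stubs; the limit set is the transitive period-two hull point itself. [folklore] -/
theorem transitiveLocalLimit_of_layeredWindows : Summit.AtomisticToContinuum.Crystallization.Theses.HullMinimality.LayeredWindows → Summit.AtomisticToContinuum.Crystallization.Theses.PerronTransitivity.TransitiveLocalLimit := by
  intro h x hx
  -- (1) layered windows at every scale, common in-layer spacing `a`
  obtain ⟨a, ha, ha1, hW⟩ := h x hx
  -- (2)–(4) the transitive period-two hull point
  obtain ⟨A, s, z, S, -, -, -, -, -, hH, hne, hsep, hU⟩ := periodTwoHullPoint_transitive x hx a ha ha1 hW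
  -- (5) subsequence and translations
  obtain ⟨σ, τ, hσ, hmatch⟩ := stub_extract x S hH
  exact ⟨S, σ, τ, hne, ⟨1 / 2, one_half_pos, hsep⟩, hσ, hmatch, hU⟩

/-- **Corollary**: route `LaminarSixThreeThree`'s target `LaminarBarlowWindows` (stmt-AtomisticToContinuum-14292)
implies `TransitiveLocalLimit`, through the landed bridge `PeriodicWindowsSketch.LayeredWindows_of_laminarBarlowWindows`
(14292 ⇒ 11778). [folklore] -/
theorem transitiveLocalLimit_of_laminarBarlowWindows
    (h : Summit.AtomisticToContinuum.Crystallization.Theses.LaminarSixThreeThree.LaminarBarlowWindows) :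
    Summit.AtomisticToContinuum.Crystallization.Theses.PerronTransitivity.TransitiveLocalLimit :=
  transitiveLocalLimit_of_layeredWindows (PeriodicWindowsSketch.LayeredWindows_of_laminarBarlowWindows h)

/-! ## By-product: the periodic infimum is attained (item 0627) and `LayeredWindows` closes the sub-problem -/

/-- The energy per particle of a periodic configuration EVERY site of which is bound at exactly `2E*` is `E*`.
[folklore] -/
theorem energyPerParticle_eq_of_siteSum_eq (P : PeriodicConfiguration 3) (u : ℝ)
    (hU : ∀ p ∈ P.points, (∑' q : {q : EuclideanSpace ℝ (Fin 3) // q ∈ P.points ∧ q ≠ p},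
      lennardJones (dist p (q : EuclideanSpace ℝ (Fin 3)))) = 2 * u) :
    P.energyPerParticle lennardJones = u := by
  unfold PeriodicConfiguration.energyPerParticle
  rw [Finset.sum_congr rfl fun y hy => hU y (P.mem_points_of_mem_motif hy), Finset.sum_const, nsmul_eq_mul]
  have hcard : (P.motif.card : ℝ) ≠ 0 := by exact_mod_cast P.motif_nonempty.card_pos.ne'
  field_simp

/-- **`LayeredWindows → CrysPeriodicMinAttained`** (item stmt-AtomisticToContinuum-0627, rank-4 crux of route
`HullMinimality`, verbatim its decl): ground states exist (`LennardJonesGroundStatesExist_holds`); their transitive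
period-two hull point is the point set of a periodic configuration `P` (`LayeredHull.pgl_readoff`, period 2), every site
of which is bound at exactly `2E*`, so `e(P) = E* = ⨅_Q e(Q)` is a least element of the range
(`ChargedEnergyGapNegative.eStar_le`). [folklore] -/
theorem crysPeriodicMinAttained_of_layeredWindows : Summit.AtomisticToContinuum.Crystallization.Theses.HullMinimality.LayeredWindows → Summit.AtomisticToContinuum.Crystallization.Theses.HullMinimality.CrysPeriodicMinAttained := by
  intro h
  choose x hx using LennardJonesGroundStatesExist_holds
  obtain ⟨a, ha, ha1, hW⟩ := h x hx
  obtain ⟨A, s, z, S, hS, -, hz, hfault, hconst, -, -, -, hU⟩ := periodTwoHullPoint_transitive x hx a ha ha1 hW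
  obtain ⟨P, hP⟩ := pgl_readoff a ha A s z hz hfault hconst
  have hPS : P.points = S := by rw [hP, hS]
  have heP : P.energyPerParticle lennardJones = ⨅ Q : PeriodicConfiguration 3, Q.energyPerParticle lennardJones := by
    refine energyPerParticle_eq_of_siteSum_eq P _ ?_
    rw [hPS]
    exact hU
  refine ⟨P, ⟨P, rfl⟩, ?_⟩
  rintro _ ⟨Q, rfl⟩
  rw [heP]
  exact Summit.AtomisticToContinuum.Crystallization.Theorems.ChargedEnergyGapNegative.eStar_le Q

/-- **`LayeredWindows → Crystallization`**: with 0627 supplied by `crysPeriodicMinAttained_of_layeredWindows`, the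
deciding theorem `HullMinimality.closes` of route `HullMinimality` needs ONLY its rank-2 crux `LayeredWindows`
(stmt-AtomisticToContinuum-11778); every other hypothesis is a proved item (11779 `PeriodicGivenLayered_proof`, 3243
`PrestressSplitKorn.stub_hullCriterion`, 11780 `hullCriterionConverse_proof`, 0626 `CrysEnergyLimit_holds`, 11781
`hullMinimality_assembly_proof`) or follows from them (`PeriodicWindows`). [folklore] -/
theorem crystallization_of_layeredWindows
    (h : Summit.AtomisticToContinuum.Crystallization.Theses.HullMinimality.LayeredWindows) : _root_.Crystallization := by
  have hPGL : HullMinimality.PeriodicGivenLayered := PeriodicGivenLayered_proof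
  have hPW : HullMinimality.PeriodicWindows := fun x hx => hPGL x hx (h x hx)
  exact HullMinimality.closes hPW h hPGL (crysPeriodicMinAttained_of_layeredWindows h)
    PrestressSplitKorn.stub_hullCriterion
    Summit.AtomisticToContinuum.Crystallization.Theorems.hullCriterionConverse_proof HullMinimality.CrysEnergyLimit_holds
    Summit.AtomisticToContinuum.Crystallization.Theorems.hullMinimality_assembly_proof

/-- **`LaminarBarlowWindows → Crystallization`** (stmt-AtomisticToContinuum-14292 ⇒ the sub-problem), by the landed
bridge 14292 ⇒ 11778. [folklore] -/
theorem crystallization_of_laminarBarlowWindows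
    (h : Summit.AtomisticToContinuum.Crystallization.Theses.LaminarSixThreeThree.LaminarBarlowWindows) :
    _root_.Crystallization :=
  crystallization_of_layeredWindows (PeriodicWindowsSketch.LayeredWindows_of_laminarBarlowWindows h)

end Summit.AtomisticToContinuum.Crystallization.Theorems.TransitiveLocalLimitMotifTwo

end
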